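import Summits.Ventures.Crystal3D.Theorems.StickyWulffConstantStackingLiminfSkewFull
import Summits.Ventures.Crystal3D.Theorems.StickyWulffConstantStackingLiminfSkewPointwise
import Summits.Ventures.Crystal3D.Theorems.StickyWulffConstantStackingLiminfOccupiedVacantOverlap
import HarnessLib

/-!
# The SKEW BOUND, pointwise form (step S4 of stub (B) `stub_mollifiedUpper`, line `LayerChain` v4, crux
# `StackingLiminf`, stmt-Ventures-19145)

Route `StickyWulffConstant` of the venture `Summits/Ventures/Crystal3D` (cell `crystal3d-full`).
`abs_skew_pointwise`: for a Hägg word `σ`, an injective configuration `x ⊂ barlowStacking 1 √(2/3) σ`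
indexed by `idx`, `K ≥ 1`, a point `y` and a lateral index box `Gbox` containing the occupied lateral
indices and every site laterally `K`-close to `y` in the layers `K`-close to `y`: with
`E(y) = Σ_{i : σ (idx i).1 ≠ 1} φ_K(y − x_i) − window σ K (y₂)·Σ_i φ_K(y − x_i)`,
`v = dens x K y`, `u = ` the vacant sum over `F(y) = Kset(y) ×ˢ Gbox` (`Kset(y)` = layers within `K`):
(1) `|E(y)| ≤ v`; (2) `|E(y)| ≤ u + 8K·δ_K` (`δ_K` the per-layer quadrature error of `…LayerSum`);
(3) `1 − 96√2·bumpConst/K ≤ v + u`.  Ingredients: `abs_occSkew_le`, `abs_skewFull_le`, `card_layers_le`,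
`sqrt_two_mul_integral_bump_sub_le_sum` + R1.  The integrated bound `∫|E| ≤ C(KD + N/K)` (hypothesis of
wulff-p2's `mollifiedUpper_of_skewBound`) follows with `…OccupiedVacantOverlap`; see `…SkewBoundIntegral`.
WHAT THIS IS NOT: not stub (B); rung F-C1 not moved.
-/

noncomputable section

namespace Summit.Ventures.Crystal3D.Theorems.PlateauHeight

open MeasureTheory Finset
open Literature.MathematicalPhysics.StatisticalMechanics
open Summit.Ventures.Crystal3D.Cruxes.StackingLiminf.LayerChainV4 (bump bumpConst dens layerProf window)
open Summit.Ventures.Crystal3D.LayerChain (dot3)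

/-- Lateral length is at most the 3-D length. -/
theorem sqrt_lateral_le_sqrt_dot3 (d : Fin 3 → ℝ) :
    Real.sqrt (d 0 ^ 2 + d 1 ^ 2) ≤ Real.sqrt (dot3 d d) := by
  apply Real.sqrt_le_sqrt
  simp only [dot3]
  nlinarith [sq_nonneg (d 2)]

/-- **Pointwise skew bound.** -/
theorem abs_skew_pointwise {σ : ℤ → ℤ} (hσ : IsHaggSeq σ) {N : ℕ}
    (x : Fin N → EuclideanSpace ℝ (Fin 3)) (hx : Function.Injective x) (idx : Fin N → ℤ × ℤ × ℤ)
    (hidx : ∀ i, x i = barlowPos 1 (Real.sqrt (2 / 3)) σ (idx i).1 (idx i).2.1 (idx i).2.2)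
    {K : ℝ} (hK : 1 ≤ K) (y : Fin 3 → ℝ) (Gbox : Finset (ℤ × ℤ))
    (hGocc : ∀ i, (idx i).2 ∈ Gbox)
    (hGnear : ∀ k i j : ℤ, |y 2 - k * Real.sqrt (2 / 3)| < K →
      Real.sqrt ((y 0 - ((i : ℝ) + j / 2 + haggLabel σ k / 2)) ^ 2 +
        (y 1 - (Real.sqrt 3 / 2 * j + Real.sqrt 3 * haggLabel σ k / 6)) ^ 2) < K → (i, j) ∈ Gbox) :
    let Kset : Finset ℤ := (finite_layers (y 2) K).toFinset
    let u : ℝ := ∑ t ∈ (Kset ×ˢ Gbox).filter (fun t => t ∉ univ.image idx),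
      bump K (fun l => y l - (barlowPos 1 (Real.sqrt (2 / 3)) σ t.1 t.2.1 t.2.2) l)
    let E : ℝ := (∑ i ∈ univ.filter (fun i => σ (idx i).1 ≠ 1), bump K (y - WithLp.ofLp (x i))) -
      window σ K (y 2) * ∑ i, bump K (y - WithLp.ofLp (x i))
    |E| ≤ dens x K y ∧
    |E| ≤ u + 8 * K * (2 / Real.sqrt 3 * (12 * bumpConst / K ^ 4 * ((2 * (K + 2)) * (2 * (K + 2))))) ∧
    1 - 96 * Real.sqrt 2 * bumpConst / K ≤ dens x K y + u := by
  classical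
  intro Kset u E
  have hK0 : 0 < K := by linarith
  have hb := bumpConst_pos
  have hh0 : 0 < Real.sqrt (2 / 3) := Real.sqrt_pos.2 (by norm_num)
  have hinj : Function.Injective idx := by
    intro a c hac; apply hx; rw [hidx a, hidx c, hac]
  set F : Finset (ℤ × ℤ × ℤ) := Kset ×ˢ Gbox with hF
  set P : ℤ × ℤ × ℤ → (Fin 3 → ℝ) := fun t =>
    WithLp.ofLp (barlowPos 1 (Real.sqrt (2 / 3)) σ t.1 t.2.1 t.2.2) with hP
  set φ : ℤ × ℤ × ℤ → ℝ := fun t => bump K (fun l => y l - P t l) with hφ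
  have hφ0 : ∀ t, 0 ≤ φ t := fun t => bump_nonneg hK0 _
  have hKset_mem : ∀ k : ℤ, k ∈ Kset ↔ |y 2 - k * Real.sqrt (2 / 3)| < K := fun k => by
    simp only [Kset, Set.Finite.mem_toFinset, Set.mem_setOf_eq]
  -- the occupied index set inside `F`
  set O : Finset (ℤ × ℤ × ℤ) := F.filter (fun t => t ∈ univ.image idx) with hO
  have hOF : O ⊆ F := filter_subset _ _
  have hFO : F \ O = F.filter (fun t => t ∉ univ.image idx) := by
    ext t
    simp only [hO, Finset.mem_sdiff, Finset.mem_filter]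
    tauto
  -- a ball outside `F` has its layer outside `Kset`, hence its bump vanishes at `y`
  have hzero : ∀ i, idx i ∉ F → bump K (y - WithLp.ofLp (x i)) = 0 := by
    intro i hi
    have hk : (idx i).1 ∉ Kset := by
      intro hk; apply hi
      rw [hF, Finset.mem_product]
      exact ⟨hk, hGocc i⟩
    rw [hKset_mem, not_lt] at hk
    refine bump_eq_zero_of_coord hK0 2 ?_
    have : (y - WithLp.ofLp (x i)) 2 = y 2 - (idx i).1 * Real.sqrt (2 / 3) := by
      rw [Pi.sub_apply, hidx i, barlowPos_apply_two]
    rw [this]; exact hk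
  -- occupied sums over `O` are the ball sums
  have hocc_eq : ∀ (m : ℤ × ℤ × ℤ → Prop) [DecidablePred m],
      ∑ t ∈ O.filter m, φ t = ∑ i ∈ univ.filter (fun i => m (idx i)), bump K (y - WithLp.ofLp (x i)) := by
    intro m _
    -- `O.filter m = image idx of {i | idx i ∈ F ∧ m (idx i)}`
    have hOm : O.filter m = (univ.filter (fun i => idx i ∈ F ∧ m (idx i))).image idx := by
      ext t
      simp only [hO, mem_filter, mem_image, mem_univ, true_and]
      constructor
      · rintro ⟨⟨htF, i, rfl⟩, hm⟩; exact ⟨i, ⟨htF, hm⟩, rfl⟩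
      · rintro ⟨i, ⟨hiF, hm⟩, rfl⟩; exact ⟨⟨hiF, i, rfl⟩, hm⟩
    rw [hOm, Finset.sum_image fun a _ c _ hac => hinj hac]
    -- add the balls outside `F` (zero terms)
    rw [← Finset.sum_filter_add_sum_filter_not (univ.filter fun i => m (idx i)) (fun i => idx i ∈ F)]
    have hz : ∑ i ∈ (univ.filter fun i => m (idx i)).filter (fun i => idx i ∉ F),
        bump K (y - WithLp.ofLp (x i)) = 0 :=
      Finset.sum_eq_zero fun i hi => hzero i (mem_filter.1 hi).2
    rw [hz, add_zero, Finset.filter_filter]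
    refine Finset.sum_congr ?_ fun i _ => ?_
    · ext i; simp only [mem_filter, mem_univ, true_and]; tauto
    · simp only [hφ, hP]; rw [← hidx i]; rfl
  have hocc : ∑ t ∈ O, φ t = dens x K y := by
    have := hocc_eq (fun _ => True)
    rw [Finset.filter_true_of_mem (fun _ _ => trivial),
      Finset.filter_true_of_mem (fun _ _ => trivial)] at this
    rw [this]
    unfold Summit.Ventures.Crystal3D.Cruxes.StackingLiminf.LayerChainV4.dens
    rfl
  have hoccm : ∑ t ∈ O.filter (fun t => σ t.1 ≠ 1), φ t =
      ∑ i ∈ univ.filter (fun i => σ (idx i).1 ≠ 1), bump K (y - WithLp.ofLp (x i)) :=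
    hocc_eq (fun t => σ t.1 ≠ 1)
  have hv_eq : (∑ i, bump K (y - WithLp.ofLp (x i))) = dens x K y := by
    unfold Summit.Ventures.Crystal3D.Cruxes.StackingLiminf.LayerChainV4.dens; rfl
  -- the window lies in `[0,1]`
  have hwin := window_mem_Icc σ hK (y 2)
  -- occupied / vacant algebra
  have halg := abs_occSkew_le F O hOF φ (fun t _ => hφ0 t) (fun t => σ t.1 ≠ 1) hwin.1 hwin.2
  rw [hoccm, hocc, hFO] at halg
  have hE : E = (∑ i ∈ univ.filter (fun i => σ (idx i).1 ≠ 1), bump K (y - WithLp.ofLp (x i))) -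
      window σ K (y 2) * dens x K y := by
    simp only [E, hv_eq]
  refine ⟨by rw [hE]; exact halg.1, ?_, ?_⟩
  · -- full-lattice skew via `abs_skewFull_le`
    rw [hE]
    refine halg.2.trans ?_
    refine add_le_add le_rfl ?_
    -- rewrite the full sums as layer sums
    have hF_sum : ∑ t ∈ F, φ t = ∑ k ∈ Kset, ∑ g ∈ Gbox,
        bump K (fun l => y l - (barlowPos 1 (Real.sqrt (2 / 3)) σ k g.1 g.2) l) := by
      rw [hF, Finset.sum_product]
    have hFm_eq : F.filter (fun t => σ t.1 ≠ 1) = (Kset.filter fun k => σ k = -1) ×ˢ Gbox := by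
      ext ⟨k, g⟩
      simp only [hF, mem_filter, mem_product]
      constructor
      · rintro ⟨⟨hk, hg⟩, hne⟩
        refine ⟨⟨hk, ?_⟩, hg⟩
        rcases hσ k with h1 | h1
        · exact absurd h1 hne
        · exact h1
      · rintro ⟨⟨hk, hm⟩, hg⟩
        exact ⟨⟨hk, hg⟩, by rw [hm]; norm_num⟩
    have hFm_sum : ∑ t ∈ F.filter (fun t => σ t.1 ≠ 1), φ t =
        ∑ k ∈ Kset.filter (fun k => σ k = -1), ∑ g ∈ Gbox,
          bump K (fun l => y l - (barlowPos 1 (Real.sqrt (2 / 3)) σ k g.1 g.2) l) := by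
      rw [hFm_eq, Finset.sum_product]
    rw [hF_sum, hFm_sum]
    have hsk := abs_skewFull_le σ hK y Kset (fun k hk => (hKset_mem k).2 hk) (fun _ => Gbox)
      (fun k hk i j hij => hGnear k i j ((hKset_mem k).1 hk) hij)
    refine hsk.trans ?_
    have hcard := card_layers_le hK (y 2)
    have hδ0 : 0 ≤ 2 / Real.sqrt 3 * (12 * bumpConst / K ^ 4 * ((2 * (K + 2)) * (2 * (K + 2)))) := by
      positivity
    calc 2 * (Kset.card : ℝ) * (2 / Real.sqrt 3 * (12 * bumpConst / K ^ 4 * ((2 * (K + 2)) * (2 * (K + 2)))))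
        ≤ 2 * (4 * K) * (2 / Real.sqrt 3 * (12 * bumpConst / K ^ 4 * ((2 * (K + 2)) * (2 * (K + 2))))) := by
          gcongr
      _ = 8 * K * (2 / Real.sqrt 3 * (12 * bumpConst / K ^ 4 * ((2 * (K + 2)) * (2 * (K + 2))))) := by ring
  · -- lower full-lattice bound
    have hFne : ∀ k i j : ℤ, Real.sqrt (dot3 (y - P (k, i, j)) (y - P (k, i, j))) < K → (k, i, j) ∈ F := by
      intro k i j hd
      rw [hF, Finset.mem_product]
      constructor
      · rw [hKset_mem]
        have := abs_apply_le_sqrt_dot3 (y - P (k, i, j)) 2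
        have e : (y - P (k, i, j)) 2 = y 2 - k * Real.sqrt (2 / 3) := by
          simp only [hP, Pi.sub_apply, barlowPos_apply_two]
        rw [e] at this
        exact lt_of_le_of_lt this hd
      · refine hGnear k i j ?_ ?_
        · have := abs_apply_le_sqrt_dot3 (y - P (k, i, j)) 2
          have e : (y - P (k, i, j)) 2 = y 2 - k * Real.sqrt (2 / 3) := by
            simp only [hP, Pi.sub_apply, barlowPos_apply_two]
          rw [e] at this
          exact lt_of_le_of_lt this hd
        · have hl := sqrt_lateral_le_sqrt_dot3 (y - P (k, i, j))
          have e0 : (y - P (k, i, j)) 0 = y 0 - ((i : ℝ) + j / 2 + haggLabel σ k / 2) := by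
            simp only [hP, Pi.sub_apply, barlowPos_apply_zero]; ring
          have e1 : (y - P (k, i, j)) 1 =
              y 1 - (Real.sqrt 3 / 2 * j + Real.sqrt 3 * haggLabel σ k / 6) := by
            simp only [hP, Pi.sub_apply, barlowPos_apply_one]; ring
          rw [e0, e1] at hl
          exact lt_of_le_of_lt hl hd
    have hlow := sqrt_two_mul_integral_bump_sub_le_sum σ hK y F hFne
    rw [rung_integral_bump K hK0] at hlow
    have e1 : Real.sqrt 2 * (1 / Real.sqrt 2) = 1 := by
      have : 0 < Real.sqrt 2 := Real.sqrt_pos.2 (by norm_num)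
      field_simp
    rw [e1] at hlow
    -- split the full sum into occupied and vacant parts
    have hsplit : ∑ t ∈ F, φ t = (∑ t ∈ O, φ t) + ∑ t ∈ F \ O, φ t := by
      rw [← Finset.sum_union disjoint_sdiff, union_sdiff_of_subset hOF]
    rw [hsplit, hocc, hFO] at hlow
    exact hlow

end Summit.Ventures.Crystal3D.Theorems.PlateauHeight

end
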